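import Summits.BirchSwinnertonDyer.BirchSwinnertonDyer.Theorems.TwoAdicConverseBDPAcLineFrobeniusGenerates
import Literature.NumberTheory.EllipticCurves.OrdinaryReductionTorsionCharacters
import HarnessLib

/-!
# AC-LINE COINVARIANT DATUM (part II): the ordinary shape `hord` from TWO NAMED PRINT FACTS (Greenberg, LNM 1716 §2),
# the combined datum `acLineCoinvariantDatumAtTwo_of_print`, and the door / (e15) «modulo PRINT» (crux
# `BDPSelmerLowerDivisibilityAtTwo`, stmt-BirchSwinnertonDyer-24728; route `TwoAdicConverse`, S3)

Helper file `--supports stmt-BirchSwinnertonDyer-24728` (cell `bsd-2adic`, seat `bsd-2adic-tower-1` GEN 55; key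
«PRINT-LEVEL RESIDUALS», director-bsd (674)(A), pen RC-660/661). THEOREMS ONLY (no definition, no named fact, no
instance, no `sorry`).  Part I (`…AcLineFrobeniusGenerates`, p792614) PROVED `hgen` outright and produced the inertial
`τ ∈ pairKer κ₁ κ₂ ⊓ inertia v̄` with `χ₂(τ) = -1`.  This part discharges the CURVE side of GEN 54's `hord` from the two
named facts of `Literature/NumberTheory/EllipticCurves/OrdinaryReductionTorsionCharacters.lean` (Greenberg, LNM 1716
§2, pp. 70–71, 76 — typed over the tree's kernel of reduction `E₁(K̄_v) = localKernelOfReduction`):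

* `F4a = ordinaryReduction_inertia_smul_of_mem_kernelReduction` — inertia acts on `C_v = Ê[p^∞]` through `χ_p`;
* `F4b = ordinaryReduction_exists_unramified_character_mod_kernelReduction` — `Γ_{K_v}` acts on `E[p^∞]/C_v` through an
  unramified character `φ` of infinite order on Frobenius.

Contents (`p = 2`; `E_K = W'` any elliptic curve over the quadratic field `K`, then `W' = W.baseChange K`):
* §1 two elementary lemmas: `val_neg_one_smul` (`(-1 mod N) • x = -x` on `N`-torsion) and ★ `exists_pow_dvd_val_mul_sub`
  (the `j`-trick: for a unit `u ≠ 1` of `ℤ₂` with `u - 1 = 2^v·w`, at every level `k` some integer `j` has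
  `2^k ∣ (ū - 1)j - 2^v`, `ū = u mod 2^k`);
* §2 ★ `ordinaryShapeAtFrobPow_of_print` — `hordFrob` of part I from F4a + F4b + part I's `τ`: with
  `F := C_{v̄} ∩ E[2^∞]` (`E₁`-membership of the embedded point), `τ|_F = -1` (F4a at `χ₂(τ) = -1`), and for a local
  Frobenius power `φ₀` of degree `m ≥ 1`, `u = φ(φ₀) = φ(Frob)^m ≠ 1` (F4b), `v = v₂(u - 1)`:
  `(res φ₀) • (j • m) - j • m - 2^v • m ∈ F` for the `j` of §1;
* §3 ★ `acLineCoinvariantDatumAtTwo_of_print` (`∃ φ ∈ ker κ₂ ⊓ D_{v̄}, hgen φ ∧ hord φ` — GEN 54's consumable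
  combination, modulo PRINT{F4a, F4b} and the local good-ordinary hypothesis at `v̄`), ★ `acLineControl_of_print`
  (the door's `hctl`), ★ `one_add_le_of_fibrePinned_of_rankOne_of_print` (**(e15) `1 + a ≤ k + m` at (β) modulo
  PRINT{F4a, F4b} only**).

HONEST LABELS: a fact is a hypothesis, not a theorem — the (e15) necessary inequality, NONDEG₀ and BUDGET at (β) now
read «modulo PRINT{Greenberg LNM 1716 §2 (two displayed sentences)}» plus the typed local hypothesis «`E_K` has good
ordinary reduction at `v̄`» (`HasGoodReductionAt v̄ ∧ 2 ∤ a_{v̄}`, the tree's rendering; from `GoodOrd W 2` at a split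
prime); `hgen` is PROVED.  Nothing closes at the ∀-level; the count of record of O2 (24728 ⟸ PRINT{dS II.4.17; OV16 1.2}
∪ RESEARCH{U, R0G, ACPIN}) does NOT move — the door delivers only the upper-bound / necessary side (door residual →
PRINT, never ACPIN → PRINT); BSD is proved for no curve by any of this; typed ≠ proved.
-/

-- D-0017: single-problem summit, the namespace repeats the problem name by design.
set_option linter.dupNamespace false
set_option autoImplicit false

noncomputable section

open scoped Classical

open NumberField IsDedekindDomain Field WeierstrassCurve
open Literature.NumberTheory.EllipticCurves Literature.NumberTheory.GaloisRepresentations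
  Literature.NumberTheory.EllipticCurves.GreenbergSelmer Literature.NumberTheory.EllipticCurves.ZpExtension
  Literature.NumberTheory.EllipticCurves.TwoVariableSelmer Literature.NumberTheory.EllipticCurves.Castella2018
open Summit.BirchSwinnertonDyer.Rank1Residual

namespace Summit.BirchSwinnertonDyer.BirchSwinnertonDyer.Theorems.TwoAdicBDPAcLineSpec

/-! ## §1. Two elementary lemmas -/

section Elementary

/-- On an element killed by `N ≥ 1`, the natural number `(-1 mod N)` acts as `-1`: `(N - 1) • x = -x`. [folklore] -/
theorem val_neg_one_smul {A : Type*} [AddCommGroup A] {N : ℕ} (hN : 0 < N) (x : A) (hx : N • x = 0) :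
    (-1 : ZMod N).val • x = -x := by
  obtain ⟨n, rfl⟩ : ∃ n, N = n + 1 := ⟨N - 1, by omega⟩
  rw [ZMod.val_neg_one, eq_neg_iff_add_eq_zero, ← succ_nsmul, hx]

/-- ★ **The `j`-trick.** For a unit `u ≠ 1` of `ℤ₂` write `u - 1 = w · 2^v` with `w ∈ ℤ₂ˣ`, `v = v₂(u - 1)`
(`PadicInt.unitCoeff_spec`).  Then at every level `k` the integer `j = w⁻¹ mod 2^k` satisfies
`2^k ∣ (ū - 1)·j - 2^v`, `ū = u mod 2^k` — i.e. on a `2^k`-torsion element `x` on which an operator acts as the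
scalar `ū`, `(ū - 1)•(j•x) = 2^v • x`.  (The elementary step turning «`φ` acts on `Ẽ[2^∞] ≅ ℚ₂/ℤ₂` by a unit
`u ≠ 1`» into the exponent `2^v` of GEN 54's `hord`.) [folklore] -/
theorem exists_pow_dvd_val_mul_sub (u : ℤ_[2]ˣ) (hu : u ≠ 1) :
    ∃ v : ℕ, ∀ k : ℕ, ∃ j : ℤ,
      ((2 ^ k : ℕ) : ℤ) ∣ (((PadicInt.toZModPow k (u : ℤ_[2])).val : ℤ) - 1) * j - 2 ^ v := by
  have hy : (u : ℤ_[2]) - 1 ≠ 0 := sub_ne_zero.2 fun h => hu (Units.ext (by rw [h, Units.val_one]))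
  set y : ℤ_[2] := (u : ℤ_[2]) - 1 with hy_def
  refine ⟨y.valuation, fun k => ?_⟩
  set w : ℤ_[2]ˣ := PadicInt.unitCoeff hy with hw_def
  haveI : NeZero (2 ^ k) := ⟨pow_ne_zero _ two_ne_zero⟩
  refine ⟨((PadicInt.toZModPow k ((w⁻¹ : ℤ_[2]ˣ) : ℤ_[2])).val : ℤ), ?_⟩
  have hspec : y = (w : ℤ_[2]) * 2 ^ y.valuation := by
    have h := PadicInt.unitCoeff_spec hy
    rw [← hw_def] at h
    simpa using h
  -- the identity in `ℤ₂`: `(u - 1) · w⁻¹ = 2^v`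
  have hZ2 : y * ((w⁻¹ : ℤ_[2]ˣ) : ℤ_[2]) = 2 ^ y.valuation := by
    nth_rewrite 1 [hspec]
    rw [mul_right_comm, Units.mul_inv, one_mul]
  -- read modulo `2^k`
  have hmod : (PadicInt.toZModPow k (u : ℤ_[2]) - 1) * PadicInt.toZModPow k ((w⁻¹ : ℤ_[2]ˣ) : ℤ_[2]) -
      2 ^ y.valuation = (0 : ZMod (2 ^ k)) := by
    have h := congrArg (PadicInt.toZModPow k) hZ2
    rw [hy_def, map_mul, map_sub, map_one, map_pow, map_ofNat] at h
    rw [h, sub_self]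
  rw [← ZMod.intCast_zmod_eq_zero_iff_dvd]
  push_cast
  rw [ZMod.natCast_zmod_val, ZMod.natCast_zmod_val]
  exact hmod

end Elementary

/-! ## §2. The ordinary shape at Frobenius powers from the two print facts -/

section OrdinaryShape

variable {K : Type} [Field K] [NumberField K]

/-- ★ **`hordFrob` FROM PRINT{F4a, F4b}.**  `K` a quadratic field with `2` split (`v ≠ v̄` above `2`), `W'` an elliptic
curve over `K` with good ORDINARY reduction at `v̄` (`HasGoodReductionAt v̄`, `2 ∤ a_{v̄}`), `κ₁, κ₂` any two
`ℤ₂`-extensions, `φ₀ ∈ Γ_{K_{v̄}}` a Frobenius power of degree `m ≥ 1`.  Then GEN 54's ordinary shape holds at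
`φ = res φ₀`: with `F = C_{v̄} = {m ∈ E[2^∞] | ι(m) ∈ E₁(K̄_{v̄})}` there is `τ ∈ pairKer κ₁ κ₂ ⊓ inertia v̄` acting
by `-1` on `F` (part I's `τ` with `χ₂(τ) = -1`, and F4a: inertia acts on `C_v` through `χ₂`), and some `v` with
`φ • (j • m) - j • m - 2^v • m ∈ F` for every `m ∈ E[2^∞]` and a suitable `j ∈ ℤ` (F4b: `Γ_{K_{v̄}}` acts on `E[2^∞]/C_v`
through an unramified `φ` with `u = φ(φ₀) = φ(Frob)^m ≠ 1`; `v = v₂(u - 1)` and the `j`-trick of §1).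
[cite: GreenbergLNM1716, §2 pp. 70–71, 76] [cite: SerreLocalFields1979, Ch. XIV §7 Thm. 2] -/
theorem ordinaryShapeAtFrobPow_of_print
    (hF4a : ordinaryReduction_inertia_smul_of_mem_kernelReduction)
    (hF4b : ordinaryReduction_exists_unramified_character_mod_kernelReduction)
    (W' : WeierstrassCurve K) [W'.IsElliptic] (hK2 : Module.finrank ℚ K = 2) (κ₁ κ₂ : ZpExtension K 2)
    {v vbar : HeightOneSpectrum (𝓞 K)} (hv : ((2 : ℕ) : 𝓞 K) ∈ v.asIdeal)
    (hvbar : ((2 : ℕ) : 𝓞 K) ∈ vbar.asIdeal) (hne : vbar ≠ v) (hgood : W'.HasGoodReductionAt vbar)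
    (hord : ¬ ((2 : ℤ) ∣ W'.frobeniusTraceAt vbar))
    (φ₀ : absoluteGaloisGroup (vbar.adicCompletion K)) (m : ℕ) (hm : 0 < m) (hfrob : IsFrobPow φ₀ (m : ℤ)) :
    ∃ F : AddSubgroup (W'.geomPrimaryTorsion 2),
      (∃ τ : absoluteGaloisGroup K, τ ∈ ZpExtension.pairKer κ₁ κ₂ ∧ τ ∈ inertia vbar ∧ ∀ n ∈ F, τ • n = -n) ∧
      ∃ v : ℕ, ∀ m : W'.geomPrimaryTorsion 2, ∃ j : ℤ,
        absGaloisRestrict K (vbar.adicCompletion K) φ₀ • (j • m) - j • m - 2 ^ v • m ∈ F := by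
  haveI : NeZero ((2 : ℕ) : K) := ⟨by norm_num⟩
  set E := vbar.adicCompletion K with hE_def
  set r := absGaloisRestrict K E with hr_def
  set emb := pointsMapOfEmb W' (closureEmb (K := K) E) with hemb_def
  set K₁ : AddSubgroup (localPoints W' E) := W'.localKernelOfReduction vbar with hK₁_def
  -- the subgroup `F = C_{v̄} ∩ E[2^∞]`
  let F : AddSubgroup (W'.geomPrimaryTorsion 2) := (K₁.comap emb).comap (W'.geomPrimaryTorsion 2).subtype
  have hF : ∀ n : W'.geomPrimaryTorsion 2, n ∈ F ↔ emb (n : geomPoints W') ∈ K₁ := fun n => Iff.rfl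
  refine ⟨F, ?_, ?_⟩
  · -- (hτ): part I's `τ` with `χ₂(τ) = -1`, acting by `-1` on `C_v` through F4a
    obtain ⟨τ, hτP, hτI, hχ⟩ :=
      exists_mem_pairKer_inf_inertia_cyclotomicCharacter_eq_neg_one hK2 κ₁ κ₂ hv hvbar hne
    obtain ⟨τ₀, hτ₀, hτ₀e⟩ := Subgroup.mem_map.1 hτI
    have hχ₀ : GaloisRep.cyclotomicCharacter E 2 τ₀ = -1 := by
      rw [← cyclotomicCharacter_absGaloisRestrict K E 2 τ₀]
      change GaloisRep.cyclotomicCharacter K 2 (r τ₀) = -1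
      rw [hr_def, show absGaloisRestrict K E τ₀ = τ from hτ₀e]
      exact hχ
    refine ⟨τ, hτP, hτI, fun n hn => ?_⟩
    obtain ⟨k, hk⟩ := (AddCommGroup.mem_primaryComponent).1 n.2
    have h := hF4a W' 2 vbar hvbar hgood hord τ₀ hτ₀ k (n : geomPoints W') hk ((hF n).1 hn)
    rw [hχ₀, Units.val_neg, Units.val_one, map_neg, map_one,
      val_neg_one_smul (pow_pos two_pos k) _ hk] at h
    apply Subtype.ext
    rw [primaryComponent.coe_smul, NegMemClass.coe_neg, ← h, ← hτ₀e]
    rfl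
  · -- (hu): F4b's unramified character, `u = φ(φ₀) ≠ 1`, and the `j`-trick
    obtain ⟨ψ, hψI, hψinf, hψ⟩ := hF4b W' 2 vbar hvbar hgood hord
    -- `ψ φ₀ = ψ(Frob)^m ≠ 1`
    obtain ⟨t, ht⟩ : ∃ t : absoluteGaloisGroup E, IsFrobPow t 1 := by
      obtain ⟨σ, hσ⟩ := exists_isAbsArithFrob_holds E
      exact ⟨σ, IsAbsArithFrob.isFrobPow_holds hσ⟩
    have htm : IsFrobPow (t ^ m) (m : ℤ) := by simpa using ht.pow m
    have hιI : φ₀ * (t ^ m)⁻¹ ∈ absInertia E := IsFrobPow.mul_inv_mem_absInertia_holds hfrob htm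
    have hu : ψ φ₀ ≠ 1 := by
      intro h1
      have h2 : ψ (φ₀ * (t ^ m)⁻¹) = 1 := hψI _ hιI
      rw [map_mul, map_inv, h1, one_mul, inv_eq_one, map_pow] at h2
      exact hψinf t ht m hm h2
    obtain ⟨v, hv'⟩ := exists_pow_dvd_val_mul_sub (ψ φ₀) hu
    refine ⟨v, fun n => ?_⟩
    obtain ⟨k, hk⟩ := (AddCommGroup.mem_primaryComponent).1 n.2
    obtain ⟨j, c, hc⟩ := hv' k
    refine ⟨j, ?_⟩
    set P : geomPoints W' := (n : geomPoints W') with hP_def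
    set ub : ℕ := (PadicInt.toZModPow k ((ψ φ₀ : ℤ_[2]ˣ) : ℤ_[2])).val with hub_def
    -- F4b at `j • P`
    have hjk : (2 ^ k) • (j • P) = 0 := by rw [smul_comm, hk, smul_zero]
    have h4b := hψ φ₀ k (j • P) hjk
    -- `(ū - 1) j - 2^v = 2^k c` kills `P`
    have hzero : ((((ub : ℤ) - 1) * j - 2 ^ v) : ℤ) • P = 0 := by
      rw [hc, mul_comm, mul_zsmul, natCast_zsmul, hk, zsmul_zero]
    rw [hF]
    have hcoe : ((absGaloisRestrict K (vbar.adicCompletion K) φ₀ • (j • n) - j • n - 2 ^ v • n :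
        W'.geomPrimaryTorsion 2) : geomPoints W') = r φ₀ • (j • P) - j • P - 2 ^ v • P := rfl
    rw [hcoe]
    have hid : ∀ Q : geomPoints W', Q - j • P - 2 ^ v • P =
        (Q - ub • (j • P)) + ((((ub : ℤ) - 1) * j - 2 ^ v) : ℤ) • P := by
      intro Q
      module
    rw [hid, hzero, add_zero]
    exact h4b

end OrdinaryShape

/-! ## §3. The combined datum and the door / (e15) «modulo PRINT{F4a, F4b}» -/

section Datum

variable {K : Type} [Field K] [NumberField K]

/-- ★ **THE AC-LINE COINVARIANT DATUM AT TWO, modulo PRINT{F4a, F4b}** (GEN 54's consumable combination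
`∃ φ ∈ ker κ₂ ⊓ D_{v̄}, hgen φ ∧ hord φ`): `W/ℚ` elliptic, `K` imaginary quadratic with `2` split (`v ≠ v̄` above `2`),
`E_K = W.baseChange K` with good ordinary reduction at `v̄`, `κ₂` anticyclotomic, `κ₁` any.  `hgen` is PROVED (part I);
`hord` comes from the two displayed sentences of Greenberg LNM 1716 §2 (F4a, F4b).
[cite: GreenbergLNM1716, §2 pp. 70–71, 76] [cite: SerreLocalFields1979, Ch. XIV §7 Thm. 2] [cite: Brink2007, Cor. 1 (p. 2136)] -/
theorem acLineCoinvariantDatumAtTwo_of_print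
    (hF4a : ordinaryReduction_inertia_smul_of_mem_kernelReduction)
    (hF4b : ordinaryReduction_exists_unramified_character_mod_kernelReduction)
    (W : WeierstrassCurve ℚ) [W.IsElliptic] (hK : IsImaginaryQuadratic K) (κ₁ κ₂ : ZpExtension K 2)
    (hκ₂ : κ₂.IsAnticyclotomic) {v vbar : HeightOneSpectrum (𝓞 K)} (hv : ((2 : ℕ) : 𝓞 K) ∈ v.asIdeal)
    (hvbar : ((2 : ℕ) : 𝓞 K) ∈ vbar.asIdeal) (hne : vbar ≠ v)
    (hgood : (W.baseChange K).HasGoodReductionAt vbar) (hord : ¬ ((2 : ℤ) ∣ (W.baseChange K).frobeniusTraceAt vbar)) :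
    ∃ φ : absoluteGaloisGroup K, φ ∈ κ₂.kerSubgroup ⊓ decomp vbar ∧
      κ₂.kerSubgroup ⊓ decomp vbar ≤ (Subgroup.closure ({φ} ∪
        ((ZpExtension.pairKer κ₁ κ₂ ⊓ inertia vbar : Subgroup (absoluteGaloisGroup K)) :
          Set (absoluteGaloisGroup K)))).topologicalClosure ∧
      ∃ F : AddSubgroup ((W.baseChange K).geomPrimaryTorsion 2),
        (∃ τ : absoluteGaloisGroup K, τ ∈ ZpExtension.pairKer κ₁ κ₂ ∧ τ ∈ inertia vbar ∧ ∀ n ∈ F, τ • n = -n) ∧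
        ∃ v : ℕ, ∀ m : (W.baseChange K).geomPrimaryTorsion 2, ∃ j : ℤ, φ • (j • m) - j • m - 2 ^ v • m ∈ F := by
  haveI : (W.baseChange K).IsElliptic := by rw [baseChange]; infer_instance
  obtain ⟨φ, hφ, ⟨φ₀, m, hm, hfrob, hφ₀⟩, hgen⟩ := acLineFrobeniusGeneratesAtTwo hK κ₁ κ₂ hκ₂ hv hvbar hne
  obtain ⟨F, hτ, hu⟩ := ordinaryShapeAtFrobPow_of_print hF4a hF4b (W.baseChange K) hK.1 κ₁ κ₂ hv hvbar hne hgood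
    hord φ₀ m hm hfrob
  rw [hφ₀] at hu
  exact ⟨φ, hφ, hgen, F, hτ, hu⟩

/-- ★ **THE DOOR'S CONTROL INPUT `hctl` modulo PRINT{F4a, F4b}**: GEN 54's `acLineControl_of_ordinaryShape` with `hgen`
PROVED and `hord` from print — `W/ℚ` elliptic, `K` imaginary quadratic with `2` split, `E_K` good ordinary at `v̄`, a
topological generator pair with `κ₂` anticyclotomic.  Conclusion = `hctl` at `(W.baseChange K, 2, κ₁, κ₂, v̄, γ₁)` VERBATIM.
[cite: SkinnerUrban2014, Prop. 3.2.8 (p. 23)] [cite: GreenbergLNM1716, §2 pp. 70–71, 76] -/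
theorem acLineControl_of_print
    (hF4a : ordinaryReduction_inertia_smul_of_mem_kernelReduction)
    (hF4b : ordinaryReduction_exists_unramified_character_mod_kernelReduction)
    (W : WeierstrassCurve ℚ) [W.IsElliptic] (hK : IsImaginaryQuadratic K)
    (κ₁ κ₂ : ZpExtension K 2) (γ₁ γ₂ : absoluteGaloisGroup K) [Fact (ZpExtension.IsTopGeneratorPair κ₁ κ₂ γ₁ γ₂)]
    (hκ₂ : κ₂.IsAnticyclotomic) {v vbar : HeightOneSpectrum (𝓞 K)} (hv : ((2 : ℕ) : 𝓞 K) ∈ v.asIdeal)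
    (hvbar : ((2 : ℕ) : 𝓞 K) ∈ vbar.asIdeal) (hne : vbar ≠ v)
    (hgood : (W.baseChange K).HasGoodReductionAt vbar) (hord : ¬ ((2 : ℤ) ∣ (W.baseChange K).frobeniusTraceAt vbar)) :
    ∃ m : ℕ, ∀ s : unrSelmer₂ κ₁ κ₂ ((W.baseChange K).geomPrimaryTorsion 2) vbar,
      conjSel₂ κ₁ κ₂ ((W.baseChange K).geomPrimaryTorsion 2) vbar γ₁ s = s →
        2 ^ m • s ∈ Set.range ((W.baseChange K).selmerAcToUnrSelmer₂ 2 κ₁ κ₂ vbar) := by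
  haveI : (W.baseChange K).IsElliptic := by rw [baseChange]; infer_instance
  exact acLineControl_of_ordinaryShapeAtFrobPow W K hK κ₁ κ₂ γ₁ γ₂ hκ₂ hv hvbar hne
    (fun φ₀ m hm hfrob ↦ ordinaryShapeAtFrobPow_of_print hF4a hF4b (W.baseChange K) hK.1 κ₁ κ₂ hv hvbar hne
      hgood hord φ₀ m hm hfrob)

end Datum

section Inequality

variable (W : WeierstrassCurve ℚ) [W.IsElliptic] [W.IsGloballyMinimal]
  {K : Type} [Field K] [NumberField K]
  (κ₁ κ₂ : ZpExtension K 2) (vbar : HeightOneSpectrum (𝓞 K)) (γ₁ γ₂ : absoluteGaloisGroup K)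
  [Fact (ZpExtension.IsTopGeneratorPair κ₁ κ₂ γ₁ γ₂)] [Fact (κ₂.IsTopGenerator γ₂)]
  (J : ℤ_[2] →+* PadicComplexInt 2) (C₀ : IwasawaAlgebra₂ 2) (G : PowerSeries (PowerSeries (PadicComplexInt 2)))
  (hpin : ∃ 𝔓 : Ideal (PowerSeries (PowerSeries (IsLocalRing.ResidueField (PadicComplexInt 2)))),
    𝔓.IsPrime ∧ PowerSeries.map (PowerSeries.map (IsLocalRing.residue (PadicComplexInt 2))) G ∉ 𝔓 ∧
    ∀ (a : ℕ) (C₁ : PowerSeries (PowerSeries (PadicComplexInt 2))),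
      IwasawaAlgebra₂.toUnr₂ 2 J C₀ = (2 : PowerSeries (PowerSeries (PadicComplexInt 2))) ^ a * C₁ →
      PowerSeries.map (PowerSeries.map (IsLocalRing.residue (PadicComplexInt 2))) C₁ ≠ 0 →
      PowerSeries.map (PowerSeries.map (IsLocalRing.residue (PadicComplexInt 2))) C₁ ∈
        𝔓 ⊔ Ideal.span {PowerSeries.map (PowerSeries.map (IsLocalRing.residue (PadicComplexInt 2))) G})
  (hG0 : PowerSeries.constantCoeff (PowerSeries.constantCoeff G) ∈ IsLocalRing.maximalIdeal (PadicComplexInt 2))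
  (a : ℕ) (C₁ : PowerSeries (PowerSeries (PadicComplexInt 2)))
  (hC : IwasawaAlgebra₂.toUnr₂ 2 J C₀ = (2 : PowerSeries (PowerSeries (PadicComplexInt 2))) ^ a * C₁)
  (hC₁ : PowerSeries.map (PowerSeries.map (IsLocalRing.residue (PadicComplexInt 2))) C₁ ≠ 0)

include hpin hG0 hC hC₁

/-- ★ **(e15) ON THE HABITAT'S RANK-ONE DATA, modulo PRINT{F4a, F4b} ONLY** (`p = 2`): the pinning datum (`FibrePinned`
unfolded, W⁺ reading `G(0,0) ∈ 𝔪`, content `toUnr₂ 2 J C₀ = 2^a · C₁` with `red C₁ ≠ 0`), LINK A₂'s binders (`K` imaginary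
quadratic, `2` split with `v ≠ v̄` above `2`, `κ₂` anticyclotomic, `rank E(K) = 1`, `#Ш[2^∞] < ∞`), `E_K` good ordinary at
`v̄`, `ch_{Λ_K}(X_Gr₂) = (C₀)`, and the two Greenberg sentences F4a, F4b: there are `m`, `k`, a unit `u` with
`(J C₀)(0,0) ∣ 2^{k+m}·u` and **`1 + a ≤ k + m`** — a pinned W⁺ datum with `k + m = 0` is impossible. [folklore]
[cite: GreenbergLNM1716, §2 pp. 70–71, 76] -/
theorem one_add_le_of_fibrePinned_of_rankOne_of_print
    (hF4a : ordinaryReduction_inertia_smul_of_mem_kernelReduction)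
    (hF4b : ordinaryReduction_exists_unramified_character_mod_kernelReduction)
    (hK : IsImaginaryQuadratic K) (hsplit : X11b.SplitsIn K 2) (hκ₂ : κ₂.IsAnticyclotomic)
    {v : HeightOneSpectrum (𝓞 K)} (hv : ((2 : ℕ) : 𝓞 K) ∈ v.asIdeal) (hvbar : ((2 : ℕ) : 𝓞 K) ∈ vbar.asIdeal)
    (hne : vbar ≠ v) (hgood : (W.baseChange K).HasGoodReductionAt vbar)
    (hord : ¬ ((2 : ℤ) ∣ (W.baseChange K).frobeniusTraceAt vbar))
    (hrank : (W.baseChange K).mordellWeilRank = 1)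
    (hsha : Finite (AddCommGroup.primaryComponent (W.baseChange K).sha 2))
    (hC₀ : XGr₂.charIdeal (W.baseChange K) 2 κ₁ κ₂ vbar γ₁ γ₂ = Ideal.span {C₀}) :
    ∃ (m k : ℕ) (u : PadicComplexInt 2), AcSelmer.XAc.HasCharValuationAt (W.baseChange K) 2 κ₂ vbar ∅ γ₂ m ∧
      IsUnit u ∧ PowerSeries.constantCoeff (PowerSeries.constantCoeff (IwasawaAlgebra₂.toUnr₂ 2 J C₀)) ∣
        (2 : PadicComplexInt 2) ^ (k + m) * u ∧ 1 + a ≤ k + m := by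
  haveI : (W.baseChange K).IsElliptic := by rw [baseChange]; infer_instance
  exact one_add_le_of_fibrePinned_of_rankOne_of_ordinaryShapeAtFrobPow W κ₁ κ₂ vbar γ₁ γ₂ J C₀ G hpin hG0 a C₁ hC hC₁
    hK hsplit hκ₂ hv hvbar hne hrank hsha
    (fun φ₀ m hm hfrob ↦ ordinaryShapeAtFrobPow_of_print hF4a hF4b (W.baseChange K) hK.1 κ₁ κ₂ hv hvbar hne
      hgood hord φ₀ m hm hfrob) hC₀

end Inequality

end Summit.BirchSwinnertonDyer.BirchSwinnertonDyer.Theorems.TwoAdicBDPAcLineSpec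

end
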